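/-
Copyright (c) 2026 the pub-hodgecm-mathlib formalisation cell (harness21).  Prover seat hodgecm-mathlib-F0P3a-p08 (g21): road «S3-ram» (LEAD F0P3a-plan (g13); owner ∕ (α)
keeper F0P3a-p06 (g16) v2.4; (Cnt2′) chair F0P3a-p07 (g15) RULINGS (13)(6), (19)): the `stub_Zhyp` composition pen — THE REGIME-B HYPERBOLIC CELL OF ROW 0 AT ODD `N`, CLOSED; 2026-09-02.
-/
import Literature.NumberTheory.Rogawski1990.TypeTwoRamifiedHyperbolicRegionShellKindsOdd                   -- ★ p849605 (this seat) (K5-B-J) FILE 3; brings FILE 2 ★ p849540 (inner counts), FILE 1 ★ p849463, ★ A-p19 (P1) p849388 + FILES 1–4, ★ chair dictionary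
import Literature.NumberTheory.Rogawski1990.DepthZeroKappaTransferTypeTwoRamifiedHyperbolicRegionSums      -- ★ p849554 (A-p12 (g25)) (K4c) `regionSums_hyperbolic_of_kindCounts_of_lock`; brings (K4b), (4a)
import Literature.NumberTheory.Rogawski1990.DepthZeroKappaTransferTypeTwoRamifiedHyperbolicTotals         -- ★ p849287 (F0P3a-p08 (g20)) `hyperbolicTotal_zero_ram_of_region_census_odd`; brings ★ p849231 (`γ′`), the CM dictionary, `valued_sq_sub_eq_one_of_not_exists_norm`
import Literature.NumberTheory.Automorphic.UnitaryLatticeTreeFrameLiteralCentring                            -- ★ `finite_setOf_latticeGraphIso_endoGL_one_antidiagonal`, `forall_not_isRoot_charpoly_smul`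
import Literature.NumberTheory.Automorphic.UnitaryLatticeTreeFramesOfInvolution                              -- ★ `isTree_latticeGraph_three_of_neg`
import HarnessLib

/-!
# The ramified `κ`-orbital integral, type (2): THE REGIME-B HYPERBOLIC CELL OF THE BLOCK-LAW SKELETON, ROW `0`, ODD `N` — `#A = R + NE·S(E_{k+1})₀ + (NP+NM)·S(P_k)₀`
# with `R`, `NE`, `NP + NM` in closed form (Rogawski 1990 §4.9; Kottwitz 1986 §3; Labesse–Langlands 1979 §2; Bruhat–Tits 1972 §10)

Topic `NumberTheory/Rogawski1990`; namespace `Literature.NumberTheory.Rogawski1990.BlockLawHyp`.  THEOREMS ONLY (no definition, no instance, no notation, no named fact,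
no `sorry`); kernel lane `--supports stmt-HodgeConjecture-24833`.  Cell `pub/hodgecm-mathlib` (D-0151), crux H413; road «S3-ram» (Literature seeding, count-neutral); the
(Cnt2′) BLOCK-LAW skeleton of keeper F0P3a-p06 (g16) (v2.4 `F0/P3a/F0P3a-p06/g16/blocklaw/v2_4/BlockLawZero.skeleton.v2_4.F0P3ap06g16.lean`, statements = v2.2), chair
F0P3a-p07 (g15) RULINGS (13)(6) ∕ (19) (this seat keeps `stub_Zhyp_zero_{even,odd}_B`): **`zhyp_zero_odd_B_ram`** = the keeper's cell `stub_Zhyp_zero_odd_B`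
VERBATIM (text `v2_2/stub_Zhyp_zero_odd_B.v2_2.F0P3ap06g16.txt`; the even twin `zhyp_zero_even_B_ram` is the sibling file `…HyperbolicCellZeroBEven`; only the three idle frame binders renamed
`_hH' _hA _hframe`, positions unchanged), CLOSED — so the keeper writes `stub_Zhyp_zero_odd_B := zhyp_zero_odd_B_ram L H' hH' w hw he hH'w _hH'i h2 ϖ hϖ hσϖ A hA hframe`.

THE COMPOSITION ([Rogawski1990] §4.9; [Kottwitz1986] §3).  Regime B: `m = 2k + 3 < N`, `n = a + k + 1` (`a ≥ 1`).  The hyperbolic literal `ι(ĝ_w, û_w)` is re-rooted and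
centred to `γ′ = ι(B₀, 1)`, `B₀ = k′⁻¹·(s·ĝ_w)·k′` (`s·û_w = 1`; `k′` = A-p12 (g25)'s W-centring conjugator, ★ A-p19 (g29) FILES 1–3 `exists_centre_forall_v_rerootedCentred_sub_one_le
_of_{odd,even}_ram`: `|(B₀ − 1)ᵢⱼ| ≤ |ϖ|^m`; `γ′ ∈ U(σ_w, Φ₃)` ★ p849231).  Its row-`0` total is ★ p849287 `hyperbolicTotal_zero_ram_of_region_census_odd` (F0P3a-p08 (g20)) in
the atoms `(#sR, NE, NP, NM)` of the root region `sR = R(γ′, m)` (finite, ★ `finite_setOf_latticeGraphIso_endoGL_one_antidiagonal`); the atoms are the KIND-KEYED region sums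
★ (K4c) `regionSums_hyperbolic_of_kindCounts_of_lock` (A-p12 (g25); lock class `c₁ := t₀ = (ϖ^m)⁻¹(½tr B₀ − 1)` itself, row `0` is class-blind; auxiliary non-square `ε := η`
from the cell's own anisotropic-form binders, ★ `valued_sq_sub_eq_one_of_not_exists_norm`) over the three KIND COUNTS ★ (K5-B-J) FILES 2–4 (this seat: `n_inner`,
`n_big = n_small`) and ★ (P1) `ncard_rootRegion_hyperbolic_of_{odd,even}_B_ram` (A-p19 (g29): `#sR`); the remaining arithmetic is `q` odd ≥ 3 (★ `card_residueField_odd_three_le`):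
`NE = 2q·n_big`, `NP + NM = q(q−1)·#sR`.  Values: odd `N`: `R = (q+1)Σ_{i<a}q^i + q^a`, `NE = 2q^(a+1)`; even `N`: `R = (q+1)Σ_{i<a}q^i`, `NE = (q+1)q^a`; both `NP + NM = (q−1)q·R`.
HONEST LABEL: HC_CM is proved only modulo the 2 remaining named inputs (hLiu418 24832, h413 24833) until rung 0 closes; nothing printed is asserted here (composition of ★
theorems); «S3-ram» has no books consequence.

## References
* [Rogawski1990] J. D. Rogawski, *Automorphic Representations of Unitary Groups in Three Variables*, Ann. of Math. Stud. 123 (1990), §4.9 Prop. 4.9.1 (a) p. 55, Lemma 4.9.3.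
* [Kottwitz1986] R. E. Kottwitz, *Base change for unit elements of Hecke algebras*, Compositio Math. 60 (1986), §3.
* [LabesseLanglands1979] J.-P. Labesse, R. P. Langlands, *L-indistinguishability for SL(2)*, Canad. J. Math. 31 (1979), §2 Lemma 2.1 p. 8.
* [BruhatTits1972] F. Bruhat, J. Tits, *Groupes réductifs sur un corps local I*, Publ. Math. IHÉS 41 (1972), §10.
-/

set_option autoImplicit false

noncomputable section

open NumberField IsDedekindDomain Matrix Polynomial ValuativeRel
open Literature.NumberTheory.Automorphic Literature.NumberTheory.Automorphic.UnitaryGroup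
open Literature.NumberTheory.Automorphic.UnitaryLatticeTree Literature.NumberTheory.Automorphic.HermitianLattice
open Literature.NumberTheory.GaloisRepresentations
open Literature.NumberTheory.Rogawski1990 Literature.NumberTheory.Rogawski1990.TypeOneRamifiedJunction
open scoped Matrix MatrixGroups ValuativeRel WithZero

namespace Literature.NumberTheory.Rogawski1990.BlockLawHyp

/-! ## §0 Arithmetic -/

/-- `2·Σ_{i<a+1} q^i = (q+1)·Σ_{i<a} q^i + q^a + 1` (the odd-`N` root-region size of the block-law texts; private arithmetic plumbing). [folklore] -/
private theorem two_mul_sum_range_succ_pow_eq {R : Type*} [CommRing R] (q : R) (a : ℕ) :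
    2 * ∑ i ∈ Finset.range (a + 1), q ^ i = (q + 1) * ∑ i ∈ Finset.range a, q ^ i + q ^ a + 1 := by
  induction a with
  | zero => simp; ring
  | succ a ih =>
    rw [Finset.sum_range_succ, mul_add, ih, Finset.sum_range_succ, pow_succ]
    ring

/-- The pooled `P + M` census over the three kinds is `q(q−1)·#sR` when `n_big = n_small` and `q = 2t + 3` (private arithmetic plumbing). [folklore] -/
private theorem census_sum_PM_eq (q t n₀ n₁ n₂ R : ℕ) (hq : q = 2 * t + 3) (h12 : n₁ = n₂) (hR : R = n₀ + n₁ + n₂) :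
    n₀ * (q * (q - 1)) + n₁ * (q * ((q - 1) / 2)) + n₂ * (q * ((q - 3) / 2)) + (n₁ * (q * ((q + 1) / 2)) + n₂ * (q * ((q - 1) / 2))) =
      q * (q - 1) * R := by
  subst hR h12
  have e1 : (q - 1) / 2 = t + 1 := by omega
  have e2 : (q + 1) / 2 = t + 2 := by omega
  have e3 : (q - 3) / 2 = t := by omega
  have e4 : q - 1 = 2 * t + 2 := by omega
  rw [e1, e2, e3, e4, hq]
  ring

variable (L : Type) [Field L] [NumberField L] [IsCMField L]

set_option maxHeartbeats 3200000 in
-- budget only: the keeper's statement-heavy socket telescope (verbatim); the proof is a composition of ★ heads.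
/-- **THE KEEPER'S CELL `stub_Zhyp_zero_odd_B`, CLOSED** (regime B, row `0`, hyperbolic literal, `N = 2n+1`): `∃ R NE NP NM, (#A : ℂ) = R + NE·S(E_{k+1})₀ +
NP·S(P_k)₀ + NM·S(P_k)₀ ∧ R = (q+1)Σ_{i<a}q^i + q^a ∧ NE = 2q^(a+1) ∧ NP + NM = (q−1)q·R` — ★ p849287 ∘ ★ (K4c) p849554 ∘ ★ (K5-B-J) p849540∕p849605 ∘ ★ (P1) p849388 at
the centred literal `γ′`. [cite: Rogawski1990, §4.9 Prop. 4.9.1 (a) p. 55, Lemma 4.9.3] [cite: Kottwitz1986, §3] [cite: LabesseLanglands1979, §2 Lemma 2.1 p. 8] [cite: BruhatTits1972, §10] -/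
theorem zhyp_zero_odd_B_ram
    (L : Type) [Field L] [NumberField L] [IsCMField L] (H' : Matrix (Fin 3) (Fin 3) L)
    {v : HeightOneSpectrum (𝓞 ↥(maximalRealSubfield L))}
    (_hH' : (H'.map (cmConjRingHom L)).transpose = H') (w : PlacesOver L v)
    (hw : IsCMField.complexConj L • w.1 = w.1) (he : v.asIdeal.ramificationIdx' w.1.asIdeal ≠ 1)
    (hH'w : IsUnit (placeForm H' w.1)) (_hH'i : hH'w.unit ∈ glInt 3 (w.1.adicCompletion L))
    (h2 : IsUnit (2 : 𝒪[(w.1.adicCompletion L)]))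
    (ϖ : w.1.adicCompletion L) (hϖ : Valued.v ϖ = WithZero.exp (-1 : ℤ)) (hσϖ : galAdicCompletionMap (L := L) (IsCMField.complexConj L) hw ϖ = -ϖ)
    (A : GL (Fin 3) (w.1.adicCompletion L)) (_hA : A ∈ glInt 3 (w.1.adicCompletion L))
    (_hframe : placeForm H' w.1 = (-(placeForm H' w.1).det) • formCongr (galAdicCompletionMap (L := L) (IsCMField.complexConj L) hw) A ((StdForm.antidiagonal 3).over (w.1.adicCompletion L))) :

    ∀ ⦃γH : ((cmDatum L 2 (Matrix.of fun i j : Fin 2 => if i.val + j.val + 1 = 2 then (1 : L) else 0)).Local v × (cmDatum L 1 (Matrix.of fun i j : Fin 1 => if i.val + j.val + 1 = 1 then (1 : L) else 0)).Local v)⦄,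
      (∀ i j : Fin 2, Valued.v (((((γH.1.val : GL (Fin 2) (UnitaryGroup.LocalRing L v)).val.map (Pi.evalRingHom (fun w' : PlacesOver L v => w'.1.adicCompletion L) w))) - 1) i j) ≤ Valued.v (ϖ ^ 2)) → Valued.v (finGammaTwo L v γH w - 1) ≤ Valued.v (ϖ ^ 2) → IsLocalGRegular L v γH →
      (¬ ∃ x : (w.1.adicCompletion L), ((((γH.1.val : GL (Fin 2) (UnitaryGroup.LocalRing L v)).val.map (Pi.evalRingHom (fun w' : PlacesOver L v => w'.1.adicCompletion L) w))).charpoly).IsRoot x) → ∀ ⦃n : ℕ⦄,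
      Valued.v ((((γH.1.val : GL (Fin 2) (UnitaryGroup.LocalRing L v)).val.map (Pi.evalRingHom (fun w' : PlacesOver L v => w'.1.adicCompletion L) w))).trace ^ 2 - 4 * (((γH.1.val : GL (Fin 2) (UnitaryGroup.LocalRing L v)).val.map (Pi.evalRingHom (fun w' : PlacesOver L v => w'.1.adicCompletion L) w))).det) = WithZero.exp (-((2 * (2 * n + 1) : ℕ) : ℤ)) → 1 ≤ n →
      ∀ (m : ℕ), Valued.v (((finCharpolyTwo L v γH).eval (finGammaTwo L v γH)) w) =
          Valued.v ((toPlace v w (HeckeCharacter.uniformizer ↥(maximalRealSubfield L) v : v.adicCompletion ↥(maximalRealSubfield L))) ^ m) →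
        ∀ β : (v.adicCompletion ↥(maximalRealSubfield L))ˣ, toPlace v w (β : v.adicCompletion ↥(maximalRealSubfield L)) =
          -(((finCharpolyTwo L v γH).eval (finGammaTwo L v γH)) w *
              (finGammaTwo L v γH w ^ 2 +
                ((γH.1.val.val : Matrix (Fin 2) (Fin 2) (LocalRing L v)).map (Pi.evalRingHom (fun w' : PlacesOver L v => w'.1.adicCompletion L) w)).det)) /
            (2 * finGammaTwo L v γH w ^ 2 *
              ((γH.1.val.val : Matrix (Fin 2) (Fin 2) (LocalRing L v)).map (Pi.evalRingHom (fun w' : PlacesOver L v => w'.1.adicCompletion L) w)).det) →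
        ∀ (P₁ : GL (Fin 3) (w.1.adicCompletion L)) (d : Fin 2 → (w.1.adicCompletion L)) (η : (w.1.adicCompletion L)) (γ₁ : GL (Fin 2) (w.1.adicCompletion L)),
        P₁ ∈ glInt 3 (w.1.adicCompletion L) →
        formCongr (galAdicCompletionMap (L := L) (IsCMField.complexConj L) hw) P₁ (placeForm (Matrix.of fun i j : Fin 3 => if i.val + j.val + 1 = 3 then (1 : L) else 0) w.1) = !![(Matrix.diagonal d) 0 0, 0, (Matrix.diagonal d) 0 1; 0, η, 0; (Matrix.diagonal d) 1 0, 0, (Matrix.diagonal d) 1 1] →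
        (∀ i, Valued.v (d i) = 1) → (∀ i, (galAdicCompletionMap (L := L) (IsCMField.complexConj L) hw) (d i) = d i) →
        (∀ z : (w.1.adicCompletion L), Valued.v z ≤ 1 → Valued.v (d 0 + d 1 * ((galAdicCompletionMap (L := L) (IsCMField.complexConj L) hw) z * z)) = 1) →
        (∀ z : (w.1.adicCompletion L), Valued.v z ≤ 1 → Valued.v (d 0 * ((galAdicCompletionMap (L := L) (IsCMField.complexConj L) hw) z * z) + d 1) = 1) →
        (galAdicCompletionMap (L := L) (IsCMField.complexConj L) hw) η = η → Valued.v η = 1 →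
        (∀ i j, Valued.v (((γ₁ : Matrix (Fin 2) (Fin 2) (w.1.adicCompletion L)) - 1) i j) ≤ Valued.v (ϖ ^ 2)) →
        γ₁ ∈ unitaryGroupOfForm (galAdicCompletionMap (L := L) (IsCMField.complexConj L) hw) (Matrix.diagonal d) →
        (γ₁ : Matrix (Fin 2) (Fin 2) (w.1.adicCompletion L)).charpoly = (((γH.1.val : GL (Fin 2) (UnitaryGroup.LocalRing L v)).val.map (Pi.evalRingHom (fun w' : PlacesOver L v => w'.1.adicCompletion L) w))).charpoly →
        Valued.v ((γ₁ : Matrix (Fin 2) (Fin 2) (w.1.adicCompletion L)).trace ^ 2 - 4 * (γ₁ : Matrix (Fin 2) (Fin 2) (w.1.adicCompletion L)).det) = WithZero.exp (-((2 * (2 * n + 1) : ℕ) : ℤ)) →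
        (¬ ∃ x : (w.1.adicCompletion L), ((γ₁ : Matrix (Fin 2) (Fin 2) (w.1.adicCompletion L)).charpoly).IsRoot x) →
        (¬ ∃ t : (w.1.adicCompletion L), t * (galAdicCompletionMap (L := L) (IsCMField.complexConj L) hw) t = η) →
          ∀ (k a : ℕ), m = 2 * k + 3 → n = a + k + 1 → m < 2 * n + 1 → ∃ (R NE NP NM : ℕ),
          ({M : Submodule (Valued.integer (w.1.adicCompletion L)) (Fin 3 → (w.1.adicCompletion L)) | IsSelfDualLattice (galAdicCompletionMap (L := L) (IsCMField.complexConj L) hw) ϖ (placeForm (Matrix.of fun i j : Fin 3 => if i.val + j.val + 1 = 3 then (1 : L) else 0) w.1) M ∧ mapGL (endoGL (((localNonsplitEquiv (IsCMField.complexConj L) (Matrix.of fun i j : Fin 2 => if i.val + j.val + 1 = 2 then (1 : L) else 0) (IsCMField.complexConj_ne_one L) w hw γH.1).val : GL (Fin 2) (w.1.adicCompletion L)), ((localNonsplitEquiv (IsCMField.complexConj L) (Matrix.of fun i j : Fin 1 => if i.val + j.val + 1 = 1 then (1 : L) else 0) (IsCMField.complexConj_ne_one L) w hw γH.2).val : GL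 (Fin 1) (w.1.adicCompletion L)))) M = M ∧ M.map ((Matrix.toLin' (((endoGL (((localNonsplitEquiv (IsCMField.complexConj L) (Matrix.of fun i j : Fin 2 => if i.val + j.val + 1 = 2 then (1 : L) else 0) (IsCMField.complexConj_ne_one L) w hw γH.1).val : GL (Fin 2) (w.1.adicCompletion L)), ((localNonsplitEquiv (IsCMField.complexConj L) (Matrix.of fun i j : Fin 1 => if i.val + j.val + 1 = 1 then (1 : L) else 0) (IsCMField.complexConj_ne_one L) w hw γH.2).val : GL (Fin 1) (w.1.adicCompletion L))) : GL (Fin 3) (w.1.adicCompletion L)) : Matrix (Fin 3) (Fin 3) (w.1.adicCompletion L)) - 1)).restrictScalars (Valued.integer (w.1.adicCompletion L))) ≤ scaleLattice (ϖ ^ 2) M}.ncard : ℂ) =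
            (R : ℂ) + (NE : ℂ) * (∑ i ∈ Finset.range (k + 1), (Ideal.absNorm v.asIdeal : ℂ) ^ (2 * i) + ∑ i ∈ Finset.range k, (Ideal.absNorm v.asIdeal : ℂ) ^ (2 * k + 1 + i)) + (NP : ℂ) * ∑ i ∈ Finset.range k, (Ideal.absNorm v.asIdeal : ℂ) ^ (2 * i) + (NM : ℂ) * ∑ i ∈ Finset.range k, (Ideal.absNorm v.asIdeal : ℂ) ^ (2 * i) ∧
          (R : ℂ) = ((Ideal.absNorm v.asIdeal : ℂ) + 1) * ∑ i ∈ Finset.range a, (Ideal.absNorm v.asIdeal : ℂ) ^ i + (Ideal.absNorm v.asIdeal : ℂ) ^ a ∧ (NE : ℂ) = 2 * (Ideal.absNorm v.asIdeal : ℂ) ^ (a + 1) ∧ (NP : ℂ) + (NM : ℂ) = ((Ideal.absNorm v.asIdeal : ℂ) - 1) * (Ideal.absNorm v.asIdeal : ℂ) * (R : ℂ) := by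
  intro γH hblk hu2 _hreg hirr n hdisc hn1 m hm β hβ P₁ d η γ₁ _hP₁ _hform _hd _hσd _han₀ _han₁ hση hηv _hγ2 _hγU _hχ _hdiscγ _hirrγ hηN kk a hmk hna hlt
  classical
  -- THE CM DRESS
  have hc1 : IsCMField.complexConj L ≠ 1 := IsCMField.complexConj_ne_one L
  have h2v : Valued.v (2 : (w.1.adicCompletion L)) = 1 := (isUnit_two_integer_iff_valued_eq_one L w.1).1 h2
  have hσσ : ∀ z : (w.1.adicCompletion L), (galAdicCompletionMap (L := L) (IsCMField.complexConj L) hw) ((galAdicCompletionMap (L := L) (IsCMField.complexConj L) hw) z) = z :=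
    galAdicCompletionMap_galAdicCompletionMap_of_smul_eq (IsCMField.complexConj L) w hc1 hw
  have hvσ : ∀ z : (w.1.adicCompletion L), Valued.v ((galAdicCompletionMap (L := L) (IsCMField.complexConj L) hw) z) = Valued.v z := fun z =>
    valued_galAdicCompletionMap (L := L) (IsCMField.complexConj L) hw z
  obtain ⟨-, -, -, hres, hnorm⟩ := ramifiedBlock_adicCompletion L v w hw he h2v
  haveI : Fintype (Valued.ResidueField (w.1.adicCompletion L)) := Fintype.ofFinite _
  haveI := isPrincipalIdealRing_integer_adicCompletion L v w
  have hqF : (Fintype.card (Valued.ResidueField (w.1.adicCompletion L)) : ℂ) = (Ideal.absNorm v.asIdeal : ℂ) := by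
    congr 1
    rw [Fintype.card_eq_nat_card, ← natCard_residueField_eq_of_compatible, natCard_residueField_eq_of_ramified (IsCMField.complexConj L) v hc1 w hw he,
      Ideal.absNorm_apply, Submodule.cardQuot_apply]
  have hqN : ((Nat.card (𝓞 ↥(maximalRealSubfield L) ⧸ v.asIdeal) : ℕ) : ℂ) = (Ideal.absNorm v.asIdeal : ℂ) := by
    rw [Ideal.absNorm_apply, Submodule.cardQuot_apply]
  obtain ⟨hqodd, hq3⟩ := card_residueField_odd_three_le (K := (w.1.adicCompletion L)) h2v
  obtain ⟨t, ht⟩ : ∃ t : ℕ, Fintype.card (Valued.ResidueField (w.1.adicCompletion L)) = 2 * t + 3 := ⟨(Fintype.card (Valued.ResidueField (w.1.adicCompletion L)) - 3) / 2, by omega⟩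
  have hq1 : 1 ≤ Fintype.card (Valued.ResidueField (w.1.adicCompletion L)) := by omega
  have hsq : ∀ t : (w.1.adicCompletion L), Valued.v (t - 1) < 1 → IsSquare t := fun t ht => by
    obtain ⟨r, hr, -⟩ := exists_sq_eq_of_valued_sub_one_lt w.1 h2v t ht
    exact ⟨r, by rw [← hr, sq]⟩
  have hϖ0 : ϖ ≠ 0 := fun h0 => by rw [h0, Valuation.map_zero] at hϖ; exact WithZero.exp_ne_zero hϖ.symm
  have hϖlt : Valued.v ϖ < 1 := by rw [hϖ, ← WithZero.exp_zero]; exact WithZero.exp_lt_exp.2 (by norm_num)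
  have hlt1 : Valued.v ϖ ^ m < 1 := pow_lt_one₀ zero_le hϖlt (by omega)
  have hT := isTree_latticeGraph_three_of_neg hσσ hvσ hϖ hσϖ hres h2v hnorm
  have hm3 : 3 ≤ m := by omega
  have hmodd : Odd m := ⟨kk + 1, by omega⟩
  -- the auxiliary non-square unit: `ε := η` (the anisotropic form's middle entry is a non-norm)
  have hε := valued_sq_sub_eq_one_of_not_exists_norm hσσ hvσ hres hnorm hση hηv hηN
  -- the centring unit `s` (`s·û₀₀ = 1`) and the W-centre `k` (A-p19 ∕ A-p12): `|B₀ − 1| ≤ |ϖ|^m`, `B₀ = k⁻¹(s·ĝ_w)k`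
  obtain ⟨s, hs⟩ := exists_units_mul_oneByOne_eq_one ((localNonsplitEquiv (IsCMField.complexConj L) (Matrix.of fun i j : Fin 1 => if i.val + j.val + 1 = 1 then (1 : L) else 0) (IsCMField.complexConj_ne_one L) w hw γH.2).val : GL (Fin 1) (w.1.adicCompletion L))
  have hsv : Valued.v (s : (w.1.adicCompletion L)) = 1 := by
    have h := congrArg Valued.v hs
    rwa [map_mul, v_oneByOne_eq_one_of_local L w hw γH.2, mul_one, map_one] at h
  obtain ⟨k, hk, hd⟩ := exists_centre_forall_v_rerootedCentred_sub_one_le_of_odd_ram L w hw he h2 ϖ hϖ hσϖ γH hblk hu2 hirr hdisc m hm β hβ s hs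
  let γ' : unitaryGroupOfForm (galAdicCompletionMap (L := L) (IsCMField.complexConj L) hw) ((StdForm.antidiagonal 3).over (w.1.adicCompletion L)) :=
    ⟨endoGL ((k⁻¹ * (Matrix.GeneralLinearGroup.scalar (Fin 2) s * ((localNonsplitEquiv (IsCMField.complexConj L) (Matrix.of fun i j : Fin 2 => if i.val + j.val + 1 = 2 then (1 : L) else 0) (IsCMField.complexConj_ne_one L) w hw γH.1).val : GL (Fin 2) (w.1.adicCompletion L))) * k), (1 : GL (Fin 1) (w.1.adicCompletion L))), endoGL_rerootedCentred_mem_unitaryGroupOfForm_ram L w hw γH s hs k hk⟩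
  have hγ' : (γ' : GL (Fin 3) (w.1.adicCompletion L)) = endoGL ((k⁻¹ * (Matrix.GeneralLinearGroup.scalar (Fin 2) s * ((localNonsplitEquiv (IsCMField.complexConj L) (Matrix.of fun i j : Fin 2 => if i.val + j.val + 1 = 2 then (1 : L) else 0) (IsCMField.complexConj_ne_one L) w hw γH.1).val : GL (Fin 2) (w.1.adicCompletion L))) * k), (1 : GL (Fin 1) (w.1.adicCompletion L))) := rfl
  -- the chair's dictionary, regime B: `|2û₀₀ − tr ĝ_w| = |ϖ^m|`
  obtain ⟨-, hB, -⟩ := typeTwo_depthDictionary_odd_ram L w hw he h2 ϖ hϖ hσϖ hblk hu2 hirr hdisc m hm β hβ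
  have hsc := (hB hlt).2.2.2
  -- the data of `B₀`: rootless, integral, `|disc| < |ϖ|^(2m)`, `|½tr B₀ − 1| = |ϖ|^m`, nilpotency of `(γ′ − 1)³` on vertices of level `< m`
  have hirrB : ∀ x : (w.1.adicCompletion L), ¬ (((((k⁻¹ * (Matrix.GeneralLinearGroup.scalar (Fin 2) s * ((localNonsplitEquiv (IsCMField.complexConj L) (Matrix.of fun i j : Fin 2 => if i.val + j.val + 1 = 2 then (1 : L) else 0) (IsCMField.complexConj_ne_one L) w hw γH.1).val : GL (Fin 2) (w.1.adicCompletion L))) * k) : GL (Fin 2) (w.1.adicCompletion L)) : Matrix (Fin 2) (Fin 2) (w.1.adicCompletion L))).charpoly).IsRoot x := forall_not_isRoot_charpoly_rerootedCentred_ram L w hw γH hirr s k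
  have hBint : IsIntMatrix (((k⁻¹ * (Matrix.GeneralLinearGroup.scalar (Fin 2) s * ((localNonsplitEquiv (IsCMField.complexConj L) (Matrix.of fun i j : Fin 2 => if i.val + j.val + 1 = 2 then (1 : L) else 0) (IsCMField.complexConj_ne_one L) w hw γH.1).val : GL (Fin 2) (w.1.adicCompletion L))) * k) : GL (Fin 2) (w.1.adicCompletion L)) : Matrix (Fin 2) (Fin 2) (w.1.adicCompletion L)) := isIntMatrix_of_forall_v_sub_one_lt_one _ fun i j => (hd i j).trans_lt hlt1
  have hdiscB : Valued.v (((((k⁻¹ * (Matrix.GeneralLinearGroup.scalar (Fin 2) s * ((localNonsplitEquiv (IsCMField.complexConj L) (Matrix.of fun i j : Fin 2 => if i.val + j.val + 1 = 2 then (1 : L) else 0) (IsCMField.complexConj_ne_one L) w hw γH.1).val : GL (Fin 2) (w.1.adicCompletion L))) * k) : GL (Fin 2) (w.1.adicCompletion L)) : Matrix (Fin 2) (Fin 2) (w.1.adicCompletion L))).trace ^ 2 - 4 * ((((k⁻¹ * (Matrix.GeneralLinearGroup.scalar (Fin 2) s * ((localNonsplitEquiv (IsCMField.complexConj L) (Matrix.of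 fun i j : Fin 2 => if i.val + j.val + 1 = 2 then (1 : L) else 0) (IsCMField.complexConj_ne_one L) w hw γH.1).val : GL (Fin 2) (w.1.adicCompletion L))) * k) : GL (Fin 2) (w.1.adicCompletion L)) : Matrix (Fin 2) (Fin 2) (w.1.adicCompletion L))).det) < Valued.v ϖ ^ (2 * m) := by
    rw [v_disc_rerootedCentred_ram L w hw γH s hs k, hdisc, hϖ, ← WithZero.exp_nsmul]
    exact WithZero.exp_lt_exp.2 (by rw [nsmul_eq_mul]; push_cast; omega)
  have hscG : Valued.v (2 * ((((localNonsplitEquiv (IsCMField.complexConj L) (Matrix.of fun i j : Fin 1 => if i.val + j.val + 1 = 1 then (1 : L) else 0) (IsCMField.complexConj_ne_one L) w hw γH.2).val : GL (Fin 1) (w.1.adicCompletion L))) : Matrix (Fin 1) (Fin 1) (w.1.adicCompletion L)) 0 0 - ((((localNonsplitEquiv (IsCMField.complexConj L) (Matrix.of fun i j : Fin 2 => if i.val + j.val + 1 = 2 then (1 : L) else 0) (IsCMField.complexConj_ne_one L) w hw γH.1).val : GL (Fin 2) (w.1.adicCompletion L)) : Matrix (Fin 2) (Fin 2) (w.1.adicCompletion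 L))).trace) = Valued.v (ϖ ^ m) := hsc
  have hcB : Valued.v (((((k⁻¹ * (Matrix.GeneralLinearGroup.scalar (Fin 2) s * ((localNonsplitEquiv (IsCMField.complexConj L) (Matrix.of fun i j : Fin 2 => if i.val + j.val + 1 = 2 then (1 : L) else 0) (IsCMField.complexConj_ne_one L) w hw γH.1).val : GL (Fin 2) (w.1.adicCompletion L))) * k) : GL (Fin 2) (w.1.adicCompletion L)) : Matrix (Fin 2) (Fin 2) (w.1.adicCompletion L))).trace / 2 - 1) = Valued.v ϖ ^ m := by
    rw [trace_coe_inv_conj_scalar_mul, mul_div_assoc, v_mul_trace_div_two_sub_one_eq h2v hs hsv, hscG, map_pow]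
  have ht0 : Valued.v ((ϖ ^ m)⁻¹ * ((((k⁻¹ * (Matrix.GeneralLinearGroup.scalar (Fin 2) s * ((localNonsplitEquiv (IsCMField.complexConj L) (Matrix.of fun i j : Fin 2 => if i.val + j.val + 1 = 2 then (1 : L) else 0) (IsCMField.complexConj_ne_one L) w hw γH.1).val : GL (Fin 2) (w.1.adicCompletion L))) * k) : GL (Fin 2) (w.1.adicCompletion L)) : Matrix (Fin 2) (Fin 2) (w.1.adicCompletion L)).trace / 2 - 1)) = 1 := by
    rw [map_mul, map_inv₀, hcB, map_pow, inv_mul_cancel₀ (pow_ne_zero m ((Valuation.ne_zero_iff _).2 hϖ0))]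
  have hΛ : ∃ a₀ : (w.1.adicCompletion L), Valued.v a₀ = 1 ∧ Valued.v (((ϖ ^ m)⁻¹ * ((((k⁻¹ * (Matrix.GeneralLinearGroup.scalar (Fin 2) s * ((localNonsplitEquiv (IsCMField.complexConj L) (Matrix.of fun i j : Fin 2 => if i.val + j.val + 1 = 2 then (1 : L) else 0) (IsCMField.complexConj_ne_one L) w hw γH.1).val : GL (Fin 2) (w.1.adicCompletion L))) * k) : GL (Fin 2) (w.1.adicCompletion L)) : Matrix (Fin 2) (Fin 2) (w.1.adicCompletion L)).trace / 2 - 1)) - ((ϖ ^ m)⁻¹ * ((((k⁻¹ * (Matrix.GeneralLinearGroup.scalar (Fin 2) s * ((localNonsplitEquiv (IsCMField.complexConj L) (Matrix.of fun i j : Fin 2 => if i.val + j.val + 1 = 2 then (1 : L) else 0) (IsCMField.complexConj_ne_one L) w hw γH.1).val : GL (Fin 2) (w.1.adicCompletion L))) * k) : GL (Fin 2) (w.1.adicCompletion L)) : Matrix (Fin 2) (Fin 2) (w.1.adicCompletion L)).trace / 2 - 1)) * a₀ ^ 2) < 1 :=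
    ⟨1, map_one _, by rw [one_pow, mul_one, sub_self, map_zero]; exact zero_lt_one⟩
  have hchar : (((γ' : GL (Fin 3) (w.1.adicCompletion L)) : Matrix (Fin 3) (Fin 3) (w.1.adicCompletion L))).charpoly = (X - C 1) * ((((k⁻¹ * (Matrix.GeneralLinearGroup.scalar (Fin 2) s * ((localNonsplitEquiv (IsCMField.complexConj L) (Matrix.of fun i j : Fin 2 => if i.val + j.val + 1 = 2 then (1 : L) else 0) (IsCMField.complexConj_ne_one L) w hw γH.1).val : GL (Fin 2) (w.1.adicCompletion L))) * k) : GL (Fin 2) (w.1.adicCompletion L)) : Matrix (Fin 2) (Fin 2) (w.1.adicCompletion L))).charpoly := by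
    rw [hγ']; exact charpoly_coe_endoGL_one _
  have hnil3 : ∀ (x : {M : Submodule (Valued.integer (w.1.adicCompletion L)) (Fin 3 → (w.1.adicCompletion L)) // IsVertex (galAdicCompletionMap (L := L) (IsCMField.complexConj L) hw) ϖ ((StdForm.antidiagonal 3).over (w.1.adicCompletion L)) M}) (e : ℕ), e + 1 ≤ m →
      x.1.map ((Matrix.toLin' (((γ' : GL (Fin 3) (w.1.adicCompletion L)) : Matrix (Fin 3) (Fin 3) (w.1.adicCompletion L)) - 1)).restrictScalars (Valued.integer (w.1.adicCompletion L))) ≤ scaleLattice (ϖ ^ e) x.1 →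
      x.1.map ((Matrix.toLin' ((((γ' : GL (Fin 3) (w.1.adicCompletion L)) : Matrix (Fin 3) (Fin 3) (w.1.adicCompletion L)) - 1) ^ 3)).restrictScalars (Valued.integer (w.1.adicCompletion L))) ≤ scaleLattice (ϖ ^ (3 * e + 1)) x.1 := by
    intro x e he hlev
    refine map_sub_one_pow_three_le_scaleLattice_of_charpoly_block_antidiagonal hϖ hchar (d := e) (by rw [sub_self, map_zero]; exact zero_le)
      (fun i j => (hd i j).trans ?_) x hlev
    exact pow_le_pow_right_of_le_one' hϖlt.le he
  -- the root region `sR` (finite) as a Finset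
  have hRfin : ({x : {M : Submodule (Valued.integer (w.1.adicCompletion L)) (Fin 3 → (w.1.adicCompletion L)) // IsVertex (galAdicCompletionMap (L := L) (IsCMField.complexConj L) hw) ϖ ((StdForm.antidiagonal 3).over (w.1.adicCompletion L)) M} | latticeGraphIso (galAdicCompletionMap (L := L) (IsCMField.complexConj L) hw) ϖ ((StdForm.antidiagonal 3).over (w.1.adicCompletion L)) γ' x = x ∧ IsSelfDualLattice (galAdicCompletionMap (L := L) (IsCMField.complexConj L) hw) ϖ ((StdForm.antidiagonal 3).over (w.1.adicCompletion L)) x.1 ∧ x.1.map ((Matrix.toLin' (((γ' : GL (Fin 3) (w.1.adicCompletion L)) : Matrix (Fin 3) (Fin 3) (w.1.adicCompletion L)) - 1)).restrictScalars (Valued.integer (w.1.adicCompletion L))) ≤ scaleLattice (ϖ ^ m) x.1}).Finite :=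
    (finite_setOf_latticeGraphIso_endoGL_one_antidiagonal hvσ h2v hsq hϖ _ hBint hirrB γ' hγ').subset fun x hx => hx.1
  have hsR : ∀ vtx, vtx ∈ hRfin.toFinset ↔ vtx ∈ {x : {M : Submodule (Valued.integer (w.1.adicCompletion L)) (Fin 3 → (w.1.adicCompletion L)) // IsVertex (galAdicCompletionMap (L := L) (IsCMField.complexConj L) hw) ϖ ((StdForm.antidiagonal 3).over (w.1.adicCompletion L)) M} | latticeGraphIso (galAdicCompletionMap (L := L) (IsCMField.complexConj L) hw) ϖ ((StdForm.antidiagonal 3).over (w.1.adicCompletion L)) γ' x = x ∧ IsSelfDualLattice (galAdicCompletionMap (L := L) (IsCMField.complexConj L) hw) ϖ ((StdForm.antidiagonal 3).over (w.1.adicCompletion L)) x.1 ∧ x.1.map ((Matrix.toLin' (((γ' : GL (Fin 3) (w.1.adicCompletion L)) : Matrix (Fin 3) (Fin 3) (w.1.adicCompletion L)) - 1)).restrictScalars (Valued.integer (w.1.adicCompletion L))) ≤ scaleLattice (ϖ ^ m) x.1} := fun vtx => hRfin.mem_toFinset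
  -- (K5-B-J) kind counts (this seat) and (P1) `#sR` (A-p19)
  have hn₀ := ncard_rootRegion_inner_hyperbolic_of_odd_B_ram L w hw he h2 ϖ hϖ hσϖ γH hblk hu2 hirr hdisc m hm β hβ s hs k hk γ' hγ' kk a hmk hna hlt
  have hn₂ := ncard_rootRegion_shellBig_hyperbolic_of_odd_B_ram L w hw he h2 ϖ hϖ hσϖ γH hblk hu2 hirr hdisc m hm β hβ s hs k hk γ' hγ' kk a hmk hna hlt η hηv hε
  have hn₁ := ncard_rootRegion_shellSmall_hyperbolic_of_odd_B_ram L w hw he h2 ϖ hϖ hσϖ γH hblk hu2 hirr hdisc m hm β hβ s hs k hk γ' hγ' kk a hmk hna hlt η hηv hε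
  have hRc := ncard_rootRegion_hyperbolic_of_odd_B_ram L w hw he h2 ϖ hϖ hσϖ γH hblk hu2 hirr hdisc m hm β hβ s hs k hk γ' hγ' kk a hmk hna
  -- (K4c) the kind-keyed region sums (A-p12), lock class `c₁ := t₀`
  obtain ⟨hcard, hNE, hNP, hNM⟩ := regionSums_hyperbolic_of_kindCounts_of_lock hσσ hvσ hσϖ hϖ hres h2v hnorm hT _ hγ' (d₀ := m) hm3 hmodd hnil3 hd hdiscB hcB
    ((ϖ ^ m)⁻¹ * ((((k⁻¹ * (Matrix.GeneralLinearGroup.scalar (Fin 2) s * ((localNonsplitEquiv (IsCMField.complexConj L) (Matrix.of fun i j : Fin 2 => if i.val + j.val + 1 = 2 then (1 : L) else 0) (IsCMField.complexConj_ne_one L) w hw γH.1).val : GL (Fin 2) (w.1.adicCompletion L))) * k) : GL (Fin 2) (w.1.adicCompletion L)) : Matrix (Fin 2) (Fin 2) (w.1.adicCompletion L)).trace / 2 - 1)) η ht0 hηv hε hRfin.toFinset hsR _ _ _ rfl rfl rfl hΛ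
  -- THE TOTAL (★ p849287) in these atoms
  have htot := hyperbolicTotal_zero_ram_of_region_census_odd L w hw he h2 ϖ hϖ hσϖ γH hu2 hirr m kk hmk s hs k hk hd γ' hγ' ((ϖ ^ m)⁻¹ * ((((k⁻¹ * (Matrix.GeneralLinearGroup.scalar (Fin 2) s * ((localNonsplitEquiv (IsCMField.complexConj L) (Matrix.of fun i j : Fin 2 => if i.val + j.val + 1 = 2 then (1 : L) else 0) (IsCMField.complexConj_ne_one L) w hw γH.1).val : GL (Fin 2) (w.1.adicCompletion L))) * k) : GL (Fin 2) (w.1.adicCompletion L)) : Matrix (Fin 2) (Fin 2) (w.1.adicCompletion L)).trace / 2 - 1)) η ht0 hηv hε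
    hRfin.toFinset hsR _ _ _ hNE hNP hNM
  refine ⟨hRfin.toFinset.card, _, _, _, htot, ?_, ?_, ?_⟩
  · -- `R = (q+1)Σ_{i<a} q^i + q^a`
    have h := hRc
    rw [Set.ncard_eq_toFinset_card _ hRfin] at h
    generalize hNdef : hRfin.toFinset.card = N at h ⊢
    have h' : ((N : ℕ) : ℂ) + 1 = 2 * ∑ i ∈ Finset.range (a + 1), ((Nat.card (𝓞 ↥(maximalRealSubfield L) ⧸ v.asIdeal) : ℕ) : ℂ) ^ i := by exact_mod_cast h
    rw [hqN, two_mul_sum_range_succ_pow_eq] at h'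
    linear_combination h'
  · -- `NE = 2·q^(a+1)`
    rw [hn₂]
    push_cast
    rw [hqF, hqN]; ring
  · -- `NP + NM = (q−1)·q·R`
    have hsum := census_sum_PM_eq _ t _ _ _ _ ht (hn₁.trans hn₂.symm) hcard
    have h := congrArg (fun t : ℕ => (t : ℂ)) hsum
    rw [Nat.cast_add] at h
    refine h.trans ?_
    generalize hRfin.toFinset.card = N
    push_cast [Nat.cast_sub hq1]
    rw [hqF]; ring

end Literature.NumberTheory.Rogawski1990.BlockLawHyp

end
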